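import Literature.Barriers.Parity.SiegelZeroPrimePairsProofs
import HarnessLib

/-!
# Matomäki–Merikoski Corollary 1.1(i) from Theorem 1.3: the printed deduction, proved

Sibling of `Literature/Barriers/Parity/SiegelZeroPrimePairs.lean` (the catalogue entry, which vendors
Matomäki–Merikoski, *Siegel zeros, twin primes, Goldbach's conjecture, and primes in short
intervals* (IMRN 2023; arXiv:2112.11412), Theorem 1.3 as the named fact
`Literature.Barriers.Parity.MatomakiMerikoski2023_pairCorrelation` and Corollary 1.1(i) as the named
fact `Literature.Barriers.Parity.MatomakiMerikoski2023_fixedShift`) and of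
`Literature/Barriers/Parity/SiegelZeroPrimePairsProofs.lean` (the same deduction for Corollary
1.1(ii), and the conductor lemmas `Literature.Barriers.Parity.SiegelCorr.*` reused here).

The source proves the corollary in one line (arXiv p. 4, after Theorem 1.4): "Corollaries 1.1(i)
and 1.2 immediately follow from Theorems 1.3 and 1.4 since by Siegel's theorem (see e.g. [MV])
`η ≪_ε q^ε`." This file formalises exactly that deduction:

* `Literature.Barriers.Parity.MatomakiMerikoski2023_fixedShift_of_pairCorrelation` —
  `MatomakiMerikoski2023_pairCorrelation → MatomakiMerikoski2023_fixedShift` (**proved**).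
  For a fixed shift `h ≥ 1` and `C ≥ 1`, Theorem 1.3 is used with the same `C`, `ε = 1/10`
  (exponent `3/5 − 1/10 = 1/2`) and `h = O(X)` constant `A = h`, at `V = log X / log q ∈
  [10, 10 log η]` for `X ∈ [q^{10}, q^{10 log η}]`. With `L = log η`, `ℓ = log q` and the target
  rate `F = e^{−C√L}`: `exp(−C√(VL)) ≤ F`; `V L⁶/η ≤ 10 L⁷e^{−L} ≤ 10 e^{(14+C)²/4} F`
  (`MatomakiMerikoski.ten_mul_pow_seven_mul_exp_neg_le`); Siegel's theorem is the tree's PROVED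
  `Literature.NumberTheory.LFunctions.Siegel.exists_one_sub_realZero_ge` (Montgomery–Vaughan
  Cor. 11.15) with exponent `1/4`, giving `η ≤ D q^{1/4}`, `D = 1/(C(1/4) log 2)`, whence
  `e^{−C√ℓ} ≤ B₀ F`, `B₀ = e^{C√(2|log D|)}` (cases `η ≤ q`, where `L ≤ ℓ`, and `q < η`, where
  `η ≤ D²`), which absorbs `exp(−C (log X)^{1/2}) ≤ e^{−C√ℓ}` (`log X ≥ 10 ℓ`).
* The correction factor `1_{φ(2^r) ∣ h} (−1)^{h/φ(2^r)} ∏_{p ∣ q', p ∤ h} (−1)/(p − 2)` of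
  Theorem 1.3 (absent from the corollary, absorbed in `O_{h,C}`) is bounded by `√(24h/q)`
  (`Literature.Barriers.Parity.SiegelCorr.abs_corr_le`: for a PRIMITIVE quadratic character mod
  `q = 2^r q'` the odd part `q'` is squarefree and `r ≤ 3`), and
  `1/√q = e^{−ℓ/2} ≤ e^{C²/2} e^{−C√ℓ} ≤ e^{C²/2} B₀ F` (`MatomakiMerikoski.exp_neg_half_le`).

The unconditional `MatomakiMerikoski2023_fixedShift_holds` would in addition need Theorem 1.3
itself (§§2–7 of the source: `β`-sieve, Henriot's bound, divisor-type correlations of `χ ∗ log`,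
exceptional-character prime sums with a Vinogradov–Korobov error term), which the tree holds only
as a named fact; nothing here is weaker or stronger than the printed statements.

## References

* K. Matomäki, J. Merikoski, *Siegel zeros, twin primes, Goldbach's conjecture, and primes in
  short intervals*, IMRN 2023:23, 20337–20384 (arXiv:2112.11412): Corollary 1.1(i), Theorem 1.3
  and the deduction printed after Theorem 1.4 (arXiv p. 4).
  [cite: MatomakiMerikoski2023, Corollary 1.1(i)]
* H. L. Montgomery, R. C. Vaughan, *Multiplicative Number Theory I*, Cambridge 2007, Cor. 11.15
  (Siegel's theorem for real zeros; tree: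
  `Literature.NumberTheory.LFunctions.Siegel.exists_one_sub_realZero_ge`).
  [cite: MontgomeryVaughan2007, Corollary 11.15]
-/

noncomputable section

open Finset Real

/-! ### Three elementary inequalities for the rates -/

namespace Literature.Barriers.Parity.MatomakiMerikoski

/-- `e^{-ℓ/2} ≤ e^{C²/2} e^{-C√ℓ}` for `ℓ ≥ 0` (complete the square: `(√ℓ − C)² ≥ 0`). [folklore] -/
theorem exp_neg_half_le (C : ℝ) {ℓ : ℝ} (hℓ : 0 ≤ ℓ) :
    Real.exp (-(ℓ / 2)) ≤ Real.exp (C ^ 2 / 2) * Real.exp (-C * Real.sqrt ℓ) := by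
  rw [← Real.exp_add]
  apply Real.exp_le_exp.mpr
  have hs : Real.sqrt ℓ ^ 2 = ℓ := Real.sq_sqrt hℓ
  nlinarith [sq_nonneg (Real.sqrt ℓ - C)]

/-- `10 L⁷ e^{-L} ≤ 10 e^{(14 + C)²/4} e^{-C√L}` for `L ≥ 0` (`L⁷ = (√L)^{14} ≤ e^{14√L}`, then
complete the square). [folklore] -/
theorem ten_mul_pow_seven_mul_exp_neg_le (C : ℝ) {L : ℝ} (hL : 0 ≤ L) :
    10 * L ^ 7 * Real.exp (-L) ≤ 10 * Real.exp ((14 + C) ^ 2 / 4) * Real.exp (-C * Real.sqrt L) := by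
  set s := Real.sqrt L with hsdef
  have hs0 : 0 ≤ s := Real.sqrt_nonneg _
  have hsL : s ^ 2 = L := Real.sq_sqrt hL
  have hs_exp : s ≤ Real.exp s := by linarith [Real.add_one_le_exp s]
  have hL7 : L ^ 7 ≤ Real.exp (14 * s) := by
    calc L ^ 7 = s ^ 14 := by rw [← hsL]; ring
      _ ≤ Real.exp s ^ 14 := pow_le_pow_left₀ hs0 hs_exp 14
      _ = Real.exp (14 * s) := by rw [← Real.exp_nat_mul]; norm_num
  have hkey : Real.exp (14 * s) * Real.exp (-L) ≤
      Real.exp ((14 + C) ^ 2 / 4) * Real.exp (-C * s) := by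
    rw [← Real.exp_add, ← Real.exp_add]
    apply Real.exp_le_exp.mpr
    nlinarith [sq_nonneg (s - (14 + C) / 2)]
  calc 10 * L ^ 7 * Real.exp (-L) ≤ 10 * Real.exp (14 * s) * Real.exp (-L) := by
        gcongr
    _ = 10 * (Real.exp (14 * s) * Real.exp (-L)) := by ring
    _ ≤ 10 * (Real.exp ((14 + C) ^ 2 / 4) * Real.exp (-C * s)) := by gcongr
    _ = 10 * Real.exp ((14 + C) ^ 2 / 4) * Real.exp (-C * s) := by ring

/-- Monotonicity of the rate: `L ≤ L'` gives `e^{-C√L'} ≤ e^{-C√L}` for `C ≥ 0`. [folklore] -/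
theorem exp_neg_mul_sqrt_antitone {C L L' : ℝ} (hC : 0 ≤ C) (h : L ≤ L') :
    Real.exp (-C * Real.sqrt L') ≤ Real.exp (-C * Real.sqrt L) := by
  apply Real.exp_le_exp.mpr
  have := Real.sqrt_le_sqrt h
  nlinarith

end Literature.Barriers.Parity.MatomakiMerikoski

/-! ### Corollary 1.1(i) from Theorem 1.3 -/

open scoped ArithmeticFunction.vonMangoldt

namespace Literature.Barriers.Parity

/-- **Matomäki–Merikoski 2023, Corollary 1.1(i) from Theorem 1.3** (the printed deduction, p. 4:
"Corollaries 1.1(i) and 1.2 immediately follow from Theorems 1.3 and 1.4 since by Siegel's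
theorem (see e.g. [MV]) `η ≪_ε q^ε`"). For a fixed shift `h ≥ 1` and `C ≥ 1`, Theorem 1.3
(`MatomakiMerikoski2023_pairCorrelation`) is applied with the same `C`, `ε = 1/10` (exponent
`3/5 − 1/10 = 1/2`) and `h = O(X)` constant `A = h`, at `V = log X / log q ∈ [10, 10 log η]` for
`X ∈ [q^{10}, q^{10 log η}]`. With `L = log η`, `ℓ = log q` and the target rate `F = e^{−C√L}`:
`exp(−C√(VL)) ≤ F` (`V ≥ 1`); `V L⁶/η ≤ 10 L⁷ e^{−L} ≤ 10 e^{(14+C)²/4} F`;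
Siegel's theorem (the tree's PROVED `Literature.NumberTheory.LFunctions.Siegel.exists_one_sub_realZero_ge`,
Montgomery–Vaughan Cor. 11.15, exponent `1/4`) gives `η ≤ D q^{1/4}`, whence `e^{−C√ℓ} ≤ B₀ F` with
`B₀ = e^{C√(2|log D|)}` (cases `η ≤ q`, where `L ≤ ℓ`, and `q < η`, where `η ≤ D²`), so
`exp(−C(log X)^{1/2}) ≤ e^{−C√ℓ} ≤ B₀ F` (`log X ≥ 10ℓ`); and the correction factor of
Theorem 1.3 is `≤ √(24h/q)` (`SiegelCorr.abs_corr_le`: the odd part of the conductor of a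
primitive quadratic character is squarefree and its `2`-part divides `8`) with
`1/√q = e^{−ℓ/2} ≤ e^{C²/2} e^{−C√ℓ} ≤ e^{C²/2} B₀ F`.
[cite: MatomakiMerikoski2023, Corollary 1.1(i) and its proof after Theorem 1.4] -/
theorem MatomakiMerikoski2023_fixedShift_of_pairCorrelation
    (h13 : MatomakiMerikoski2023_pairCorrelation) : MatomakiMerikoski2023_fixedShift := by
  intro h hh C hC
  -- Siegel's theorem (MV Cor. 11.15) with exponent `1/4`
  obtain ⟨CS, hCS, hSiegel⟩ :=
    Literature.NumberTheory.LFunctions.Siegel.exists_one_sub_realZero_ge (ε := 1 / 4) (by norm_num)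
  have hlog2 : 0 < Real.log 2 := Real.log_pos one_lt_two
  set D : ℝ := 1 / (CS * Real.log 2) with hDdef
  have hD : 0 < D := by positivity
  -- Theorem 1.3 with `C`, `ε = 1/10`, `A = h`
  have hh0 : (0 : ℝ) < h := by exact_mod_cast hh
  have hC0 : 0 < C := by linarith
  obtain ⟨K₁, hK₁, h13'⟩ := h13 C hC (1 / 10) (by norm_num) h hh0
  have htot : (0 : ℝ) < (Nat.totient h : ℝ) := by exact_mod_cast Nat.totient_pos.mpr hh
  set G : ℝ := Literature.NumberTheory.Sieve.goldbachSingularSeries h with hGdef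
  -- the constants
  set B₀ : ℝ := Real.exp (C * Real.sqrt (2 * |Real.log D|)) with hB₀def
  have hB₀1 : 1 ≤ B₀ := Real.one_le_exp (by positivity)
  set K₃ : ℝ := 10 * Real.exp ((14 + C) ^ 2 / 4) with hK₃def
  have hK₃0 : 0 < K₃ := by positivity
  refine ⟨K₁ * ((h : ℝ) / (Nat.totient h : ℝ)) * (1 + B₀ + K₃) +
      |G| * Real.sqrt (24 * h) * (Real.exp (C ^ 2 / 2) * B₀), by positivity, ?_⟩
  intro q _ hq χ hprim hquad η hη hzero X hXlo hXhi
  -- basic positivity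
  have hq2 : (2 : ℝ) ≤ q := by exact_mod_cast hq
  have hq1 : (1 : ℝ) ≤ q := by linarith
  have hq0 : (0 : ℝ) < q := by linarith
  have hlogq : Real.log 2 ≤ Real.log q := Real.log_le_log two_pos hq2
  have hℓ0 : 0 < Real.log q := lt_of_lt_of_le hlog2 hlogq
  have hη0 : (0 : ℝ) < η := by linarith
  have hη1 : (1 : ℝ) ≤ η := by linarith
  set L : ℝ := Real.log η with hLdef
  have hL1 : 1 ≤ L := by
    rw [hLdef, Real.le_log_iff_exp_le hη0]
    linarith [Real.exp_one_lt_three]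
  have hL0 : 0 < L := by linarith
  have hηL : Real.exp L = η := Real.exp_log hη0
  -- `X` and `V = log X / log q`
  have hq10 : (0 : ℝ) < (q : ℝ) ^ (10 : ℝ) := Real.rpow_pos_of_pos hq0 _
  have hX0 : 0 < X := lt_of_lt_of_le hq10 hXlo
  have hX1 : 1 ≤ X := le_trans (Real.one_le_rpow hq1 (by norm_num)) hXlo
  set V : ℝ := Real.log X / Real.log q with hVdef
  have hlogX : Real.log X = V * Real.log q := by rw [hVdef]; field_simp
  have hX : X = (q : ℝ) ^ V := by
    rw [Real.rpow_def_of_pos hq0, mul_comm, ← hlogX, Real.exp_log hX0]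
  have hlogXlo : 10 * Real.log q ≤ Real.log X := by
    have := Real.log_le_log hq10 hXlo
    rwa [Real.log_rpow hq0] at this
  have hlogXhi : Real.log X ≤ 10 * L * Real.log q := by
    have := Real.log_le_log hX0 hXhi
    rwa [Real.log_rpow hq0] at this
  have hV10 : 10 ≤ V := by
    rw [hVdef, le_div_iff₀ hℓ0]; exact hlogXlo
  have hVhi : V ≤ 10 * L := by
    rw [hVdef, div_le_iff₀ hℓ0]; exact hlogXhi
  have hV0 : 0 < V := by linarith
  -- `χ ≠ 1`
  have hne : χ ≠ 1 := by
    intro h1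
    have := (DirichletCharacter.eq_one_iff_conductor_eq_one (χ := χ)).mp h1
    rw [hprim] at this
    omega
  -- Siegel: `η ≤ D q^{1/4}`
  have hηD : η ≤ D * (q : ℝ) ^ (1 / 4 : ℝ) := by
    have hS := hSiegel q χ hquad.sq_eq_one hne (1 - 1 / (η * Real.log q)) hzero
    have hS' : CS * (q : ℝ) ^ (-(1 / 4 : ℝ)) ≤ 1 / (η * Real.log q) := by linarith
    have hpos : 0 < CS * (q : ℝ) ^ (-(1 / 4 : ℝ)) := by positivity
    have hηlog : η * Real.log q ≤ (q : ℝ) ^ (1 / 4 : ℝ) / CS := by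
      have := (le_one_div hpos (by positivity)).mp hS'
      calc η * Real.log q ≤ 1 / (CS * (q : ℝ) ^ (-(1 / 4 : ℝ))) := this
        _ = (q : ℝ) ^ (1 / 4 : ℝ) / CS := by
            rw [Real.rpow_neg hq0.le]; field_simp
    calc η = η * Real.log q / Real.log q := by field_simp
      _ ≤ ((q : ℝ) ^ (1 / 4 : ℝ) / CS) / Real.log q := by gcongr
      _ ≤ ((q : ℝ) ^ (1 / 4 : ℝ) / CS) / Real.log 2 := by gcongr
      _ = D * (q : ℝ) ^ (1 / 4 : ℝ) := by rw [hDdef]; field_simp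
  -- the target rate `F = e^{-C√L}` and the floor `e^{-C√ℓ} ≤ B₀ F`
  set F : ℝ := Real.exp (-C * Real.sqrt L) with hFdef
  have hF0 : 0 < F := Real.exp_pos _
  have hfloor : Real.exp (-C * Real.sqrt (Real.log q)) ≤ B₀ * F := by
    rcases le_or_gt η q with hle | hlt
    · have hLℓ : L ≤ Real.log q := Real.log_le_log hη0 hle
      calc Real.exp (-C * Real.sqrt (Real.log q)) ≤ F :=
            MatomakiMerikoski.exp_neg_mul_sqrt_antitone hC0.le hLℓ
        _ ≤ B₀ * F := le_mul_of_one_le_left hF0.le hB₀1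
    · -- `q < η`: then `η ≤ D q^{1/4} ≤ D √q ≤ D √η`, so `η ≤ D²` and `L ≤ 2 |log D|`
      have hchain : η ≤ D * Real.sqrt η := by
        calc η ≤ D * (q : ℝ) ^ (1 / 4 : ℝ) := hηD
          _ ≤ D * (q : ℝ) ^ (1 / 2 : ℝ) :=
              mul_le_mul_of_nonneg_left
                (Real.rpow_le_rpow_of_exponent_le hq1 (by norm_num : (1 / 4 : ℝ) ≤ 1 / 2)) hD.le
          _ = D * Real.sqrt q := by rw [Real.sqrt_eq_rpow]
          _ ≤ D * Real.sqrt η := by gcongr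
      have hs0 : 0 < Real.sqrt η := Real.sqrt_pos.mpr hη0
      have hsD : Real.sqrt η ≤ D := by
        calc Real.sqrt η = η / Real.sqrt η := Real.div_sqrt.symm
          _ ≤ D * Real.sqrt η / Real.sqrt η := by gcongr
          _ = D := by field_simp
      have hηD2 : η ≤ D ^ 2 := by
        calc η = Real.sqrt η ^ 2 := (Real.sq_sqrt hη0.le).symm
          _ ≤ D ^ 2 := pow_le_pow_left₀ hs0.le hsD 2
      have hL2 : L ≤ 2 * |Real.log D| := by
        calc L ≤ Real.log (D ^ 2) := Real.log_le_log hη0 hηD2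
          _ = 2 * Real.log D := by rw [Real.log_pow]; norm_num
          _ ≤ 2 * |Real.log D| := by linarith [le_abs_self (Real.log D)]
      have h1 : Real.exp (-C * Real.sqrt (Real.log q)) ≤ 1 := by
        rw [Real.exp_le_one_iff]
        have := mul_nonneg hC0.le (Real.sqrt_nonneg (Real.log q))
        linarith
      have h2 : 1 ≤ B₀ * F := by
        have hBF : Real.exp (-C * Real.sqrt (2 * |Real.log D|)) ≤ F :=
          MatomakiMerikoski.exp_neg_mul_sqrt_antitone hC0.le hL2
        have hB₀inv : B₀ * Real.exp (-C * Real.sqrt (2 * |Real.log D|)) = 1 := by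
          rw [hB₀def, ← Real.exp_add]; simp
        calc (1 : ℝ) = B₀ * Real.exp (-C * Real.sqrt (2 * |Real.log D|)) := hB₀inv.symm
          _ ≤ B₀ * F := by gcongr
      linarith
  -- E1 = exp(−C√(V L)) ≤ F
  have hE1 : Real.exp (-C * Real.sqrt (V * L)) ≤ F :=
    MatomakiMerikoski.exp_neg_mul_sqrt_antitone hC0.le (le_mul_of_one_le_left hL0.le (by linarith))
  -- E2 = exp(−C (log X)^{1/2}) ≤ e^{−C√ℓ} ≤ B₀ F
  have hE2 : Real.exp (-C * Real.log X ^ (3 / 5 - 1 / 10 : ℝ)) ≤ B₀ * F := by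
    have hexp : (3 / 5 - 1 / 10 : ℝ) = 1 / 2 := by norm_num
    rw [hexp, ← Real.sqrt_eq_rpow]
    calc Real.exp (-C * Real.sqrt (Real.log X)) ≤ Real.exp (-C * Real.sqrt (Real.log q)) :=
          MatomakiMerikoski.exp_neg_mul_sqrt_antitone hC0.le (by linarith)
      _ ≤ B₀ * F := hfloor
  -- E3 = V L⁶/η ≤ 10 L⁷ e^{−L} ≤ K₃ F
  have hE3 : V * L ^ 6 / η ≤ K₃ * F := by
    have hVL : V * L ^ 6 ≤ 10 * L ^ 7 := by
      have hL6 : 0 < L ^ 6 := pow_pos hL0 6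
      calc V * L ^ 6 ≤ (10 * L) * L ^ 6 := mul_le_mul_of_nonneg_right hVhi hL6.le
        _ = 10 * L ^ 7 := by ring
    calc V * L ^ 6 / η ≤ 10 * L ^ 7 / η := div_le_div_of_nonneg_right hVL hη0.le
      _ = 10 * L ^ 7 * Real.exp (-L) := by rw [Real.exp_neg, hηL, div_eq_mul_inv]
      _ ≤ 10 * Real.exp ((14 + C) ^ 2 / 4) * Real.exp (-C * Real.sqrt L) :=
          MatomakiMerikoski.ten_mul_pow_seven_mul_exp_neg_le C hL0.le
      _ = K₃ * F := by rw [hK₃def, hFdef]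
  -- the correction factor: `|corr| ≤ √(24h/q) ≤ √(24h) e^{C²/2} B₀ F`
  have hcorr := SiegelCorr.abs_corr_le (R := ℂ) χ hprim hquad hh
  have hsqrtq : 1 / Real.sqrt q ≤ Real.exp (C ^ 2 / 2) * B₀ * F := by
    have hsq : Real.sqrt q = Real.exp (Real.log q / 2) := by
      rw [← Real.log_sqrt hq0.le, Real.exp_log (Real.sqrt_pos.mpr hq0)]
    calc 1 / Real.sqrt q = Real.exp (-(Real.log q / 2)) := by
          rw [hsq, Real.exp_neg, one_div]
      _ ≤ Real.exp (C ^ 2 / 2) * Real.exp (-C * Real.sqrt (Real.log q)) :=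
          MatomakiMerikoski.exp_neg_half_le C hℓ0.le
      _ ≤ Real.exp (C ^ 2 / 2) * (B₀ * F) := by gcongr
      _ = Real.exp (C ^ 2 / 2) * B₀ * F := by ring
  have hcorr' : Real.sqrt (24 * h / q) ≤ Real.sqrt (24 * h) * (Real.exp (C ^ 2 / 2) * B₀) * F := by
    rw [Real.sqrt_div' _ hq0.le]
    calc Real.sqrt (24 * h) / Real.sqrt q = Real.sqrt (24 * h) * (1 / Real.sqrt q) := by ring
      _ ≤ Real.sqrt (24 * h) * (Real.exp (C ^ 2 / 2) * B₀ * F) := by gcongr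
      _ = Real.sqrt (24 * h) * (Real.exp (C ^ 2 / 2) * B₀) * F := by ring
  -- Theorem 1.3
  have hhX : (h : ℝ) ≤ h * X := le_mul_of_one_le_right hh0.le hX1
  have hmain := h13' q hq χ hprim hquad η hη hzero V X hV10 hX h hh hhX
  -- assemble
  set S : ℝ := ∑ n ∈ Icc 1 ⌊X⌋₊, Λ n * Λ (n + h) with hSdef
  set corr : ℝ := (if Nat.totient (2 ^ padicValNat 2 q) ∣ h then
        (-1 : ℝ) ^ (h / Nat.totient (2 ^ padicValNat 2 q)) *
          ∏ p ∈ (q / 2 ^ padicValNat 2 q).primeFactors.filter (fun p => ¬ p ∣ h),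
            (-1 : ℝ) / ((p : ℝ) - 2)
      else 0) with hcorrdef
  have htri : |S - X * G| ≤ |S - X * G * (1 + corr)| + |X * G * (1 + corr) - X * G| :=
    abs_sub_le _ _ _
  have hmid : |X * G * (1 + corr) - X * G| = X * |G| * |corr| := by
    rw [show X * G * (1 + corr) - X * G = X * G * corr by ring, abs_mul, abs_mul, abs_of_pos hX0]
  have hsum : Real.exp (-C * Real.sqrt (V * L)) + Real.exp (-C * Real.log X ^ (3 / 5 - 1 / 10 : ℝ))
      + V * L ^ 6 / η ≤ (1 + B₀ + K₃) * F := by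
    linarith
  have hc0 : 0 ≤ K₁ * ((h : ℝ) / (Nat.totient h : ℝ)) * X := by positivity
  calc |S - X * G| ≤ |S - X * G * (1 + corr)| + |X * G * (1 + corr) - X * G| := htri
    _ ≤ K₁ * ((h : ℝ) / (Nat.totient h : ℝ)) * X *
          (Real.exp (-C * Real.sqrt (V * L)) + Real.exp (-C * Real.log X ^ (3 / 5 - 1 / 10 : ℝ))
            + V * L ^ 6 / η) + X * |G| * |corr| := by
        rw [hmid]; exact add_le_add hmain le_rfl
    _ ≤ K₁ * ((h : ℝ) / (Nat.totient h : ℝ)) * X * ((1 + B₀ + K₃) * F) +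
          X * |G| * (Real.sqrt (24 * h) * (Real.exp (C ^ 2 / 2) * B₀) * F) := by
        gcongr
        · exact hcorr.trans hcorr'
    _ = (K₁ * ((h : ℝ) / (Nat.totient h : ℝ)) * (1 + B₀ + K₃) +
          |G| * Real.sqrt (24 * h) * (Real.exp (C ^ 2 / 2) * B₀)) * X * F := by ring
    _ = _ := by rw [hFdef]

set_option maxHeartbeats 800000 in
/-- **Corollary 1.1(i) from the CLASSICAL form of Theorem 1.3.** The deduction above only uses
Theorem 1.3 with ONE value of the Vinogradov–Korobov parameter; in fact a version of Theorem 1.3 whose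
second error term is the classical `exp(−c₀ √log X)` for a FIXED absolute `c₀ > 0` (which is what the
classical zero-free region of `ζ` gives through Lemma 2.4, see `SiegelZeroPrimePairsLemma24.lean`)
already implies Corollary 1.1(i) for EVERY `C ≥ 1`: apply Siegel's theorem with the exponent
`ε = min(1/4, 10c₀²/C²)` (`η ≤ D_ε q^ε`, so `log η ≤ |log D_ε| + ε log q`); since `log X ≥ 10 log q`,
`exp(−c₀√log X) ≤ exp(−C√(ε log q)) ≤ e^{C√|log D_ε|} e^{−C√log η}`. The other two error terms and
the correction factor are treated exactly as in `MatomakiMerikoski2023_fixedShift_of_pairCorrelation`.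
The hypothesis is the statement of Theorem 1.3 (`MatomakiMerikoski2023_pairCorrelation`, positive shifts
`h ≤ A X`) with `exp(−C (log X)^{3/5−ε})` replaced by `exp(−c₀ √log X)`.
[cite: MatomakiMerikoski2023, Corollary 1.1(i), Theorem 1.3 and the deduction after Theorem 1.4] -/
theorem MatomakiMerikoski2023_fixedShift_of_pairCorrelation_classical {c₀ : ℝ} (hc₀ : 0 < c₀)
    (h13 : ∀ C : ℝ, 1 ≤ C → ∀ A : ℝ, 0 < A → ∃ K : ℝ, 0 < K ∧
      ∀ (q : ℕ) [NeZero q], 2 ≤ q → ∀ χ : DirichletCharacter ℂ q, χ.IsPrimitive → χ.IsQuadratic →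
        ∀ η : ℝ, 10 ≤ η → χ.LFunction ((1 - 1 / (η * Real.log q) : ℝ) : ℂ) = 0 →
          ∀ V X : ℝ, 10 ≤ V → X = (q : ℝ) ^ V → ∀ h : ℕ, 1 ≤ h → (h : ℝ) ≤ A * X →
            |(∑ n ∈ Icc 1 ⌊X⌋₊, Λ n * Λ (n + h)) -
                X * Literature.NumberTheory.Sieve.goldbachSingularSeries h *
                  (1 + if Nat.totient (2 ^ padicValNat 2 q) ∣ h then
                        (-1 : ℝ) ^ (h / Nat.totient (2 ^ padicValNat 2 q)) *
                          ∏ p ∈ (q / 2 ^ padicValNat 2 q).primeFactors.filter (fun p => ¬ p ∣ h),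
                            (-1 : ℝ) / ((p : ℝ) - 2)
                      else 0)| ≤
              K * ((h : ℝ) / (Nat.totient h : ℝ)) * X *
                (Real.exp (-C * Real.sqrt (V * Real.log η)) +
                  Real.exp (-c₀ * Real.sqrt (Real.log X)) +
                  V * Real.log η ^ (6 : ℕ) / η)) :
    MatomakiMerikoski2023_fixedShift := by
  intro h hh C hC
  have hC0 : 0 < C := by linarith
  -- Siegel's theorem (MV Cor. 11.15) with exponent `ε = min(1/4, 10c₀²/C²)`
  set ε : ℝ := min (1 / 4) (10 * c₀ ^ 2 / C ^ 2) with hεdef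
  have hε : 0 < ε := lt_min (by norm_num) (by positivity)
  have hε4 : ε ≤ 1 / 4 := min_le_left _ _
  have hεC : C ^ 2 * ε ≤ 10 * c₀ ^ 2 := by
    have : ε ≤ 10 * c₀ ^ 2 / C ^ 2 := min_le_right _ _
    rwa [le_div_iff₀ (by positivity), mul_comm] at this
  obtain ⟨CS, hCS, hSiegel⟩ :=
    Literature.NumberTheory.LFunctions.Siegel.exists_one_sub_realZero_ge hε
  have hlog2 : 0 < Real.log 2 := Real.log_pos one_lt_two
  set D : ℝ := 1 / (CS * Real.log 2) with hDdef
  have hD : 0 < D := by positivity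
  -- Theorem 1.3 (classical form) with `C`, `A = h`
  have hh0 : (0 : ℝ) < h := by exact_mod_cast hh
  obtain ⟨K₁, hK₁, h13'⟩ := h13 C hC h hh0
  have htot : (0 : ℝ) < (Nat.totient h : ℝ) := by exact_mod_cast Nat.totient_pos.mpr hh
  set G : ℝ := Literature.NumberTheory.Sieve.goldbachSingularSeries h with hGdef
  -- the constants
  set B₀ : ℝ := Real.exp (C * Real.sqrt (|Real.log D|)) with hB₀def
  have hB₀1 : 1 ≤ B₀ := Real.one_le_exp (by positivity)
  set K₃ : ℝ := 10 * Real.exp ((14 + C) ^ 2 / 4) with hK₃def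
  have hK₃0 : 0 < K₃ := by positivity
  refine ⟨K₁ * ((h : ℝ) / (Nat.totient h : ℝ)) * (1 + B₀ + K₃) +
      |G| * Real.sqrt (24 * h) * (Real.exp ((C * Real.sqrt ε) ^ 2 / 2) * B₀), by positivity, ?_⟩
  intro q _ hq χ hprim hquad η hη hzero X hXlo hXhi
  -- basic positivity
  have hq2 : (2 : ℝ) ≤ q := by exact_mod_cast hq
  have hq1 : (1 : ℝ) ≤ q := by linarith
  have hq0 : (0 : ℝ) < q := by linarith
  have hlogq : Real.log 2 ≤ Real.log q := Real.log_le_log two_pos hq2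
  have hℓ0 : 0 < Real.log q := lt_of_lt_of_le hlog2 hlogq
  have hη0 : (0 : ℝ) < η := by linarith
  have hη1 : (1 : ℝ) ≤ η := by linarith
  set L : ℝ := Real.log η with hLdef
  have hL1 : 1 ≤ L := by
    rw [hLdef, Real.le_log_iff_exp_le hη0]
    linarith [Real.exp_one_lt_three]
  have hL0 : 0 < L := by linarith
  have hηL : Real.exp L = η := Real.exp_log hη0
  -- `X` and `V = log X / log q`
  have hq10 : (0 : ℝ) < (q : ℝ) ^ (10 : ℝ) := Real.rpow_pos_of_pos hq0 _
  have hX0 : 0 < X := lt_of_lt_of_le hq10 hXlo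
  have hX1 : 1 ≤ X := le_trans (Real.one_le_rpow hq1 (by norm_num)) hXlo
  set V : ℝ := Real.log X / Real.log q with hVdef
  have hlogX : Real.log X = V * Real.log q := by rw [hVdef]; field_simp
  have hX : X = (q : ℝ) ^ V := by
    rw [Real.rpow_def_of_pos hq0, mul_comm, ← hlogX, Real.exp_log hX0]
  have hlogXlo : 10 * Real.log q ≤ Real.log X := by
    have := Real.log_le_log hq10 hXlo
    rwa [Real.log_rpow hq0] at this
  have hlogXhi : Real.log X ≤ 10 * L * Real.log q := by
    have := Real.log_le_log hX0 hXhi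
    rwa [Real.log_rpow hq0] at this
  have hV10 : 10 ≤ V := by
    rw [hVdef, le_div_iff₀ hℓ0]; exact hlogXlo
  have hVhi : V ≤ 10 * L := by
    rw [hVdef, div_le_iff₀ hℓ0]; exact hlogXhi
  have hV0 : 0 < V := by linarith
  -- `χ ≠ 1`
  have hne : χ ≠ 1 := by
    intro h1
    have := (DirichletCharacter.eq_one_iff_conductor_eq_one (χ := χ)).mp h1
    rw [hprim] at this
    omega
  -- Siegel: `η ≤ D q^{ε}`, hence `L ≤ |log D| + ε log q`
  have hηD : η ≤ D * (q : ℝ) ^ ε := by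
    have hS := hSiegel q χ hquad.sq_eq_one hne (1 - 1 / (η * Real.log q)) hzero
    have hS' : CS * (q : ℝ) ^ (-ε) ≤ 1 / (η * Real.log q) := by linarith
    have hpos : 0 < CS * (q : ℝ) ^ (-ε) := by positivity
    have hηlog : η * Real.log q ≤ (q : ℝ) ^ ε / CS := by
      have := (le_one_div hpos (by positivity)).mp hS'
      calc η * Real.log q ≤ 1 / (CS * (q : ℝ) ^ (-ε)) := this
        _ = (q : ℝ) ^ ε / CS := by
            rw [Real.rpow_neg hq0.le]; field_simp
    calc η = η * Real.log q / Real.log q := by field_simp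
      _ ≤ ((q : ℝ) ^ ε / CS) / Real.log q := by gcongr
      _ ≤ ((q : ℝ) ^ ε / CS) / Real.log 2 := by gcongr
      _ = D * (q : ℝ) ^ ε := by rw [hDdef]; field_simp
  have hLle : L ≤ |Real.log D| + ε * Real.log q := by
    calc L ≤ Real.log (D * (q : ℝ) ^ ε) := Real.log_le_log hη0 hηD
      _ = Real.log D + ε * Real.log q := by
          rw [Real.log_mul hD.ne' (Real.rpow_pos_of_pos hq0 ε).ne', Real.log_rpow hq0]
      _ ≤ |Real.log D| + ε * Real.log q := by linarith [le_abs_self (Real.log D)]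
  -- the target rate `F = e^{-C√L}` and the floor `e^{-C√(εℓ)} ≤ B₀ F`
  set F : ℝ := Real.exp (-C * Real.sqrt L) with hFdef
  have hF0 : 0 < F := Real.exp_pos _
  have hfloor : Real.exp (-C * Real.sqrt (ε * Real.log q)) ≤ B₀ * F := by
    rw [hB₀def, hFdef, ← Real.exp_add, Real.exp_le_exp]
    have h1 : Real.sqrt L ≤ Real.sqrt (|Real.log D|) + Real.sqrt (ε * Real.log q) := by
      have ha : 0 ≤ |Real.log D| := abs_nonneg _
      have hb : 0 ≤ ε * Real.log q := by positivity
      calc Real.sqrt L ≤ Real.sqrt (|Real.log D| + ε * Real.log q) := Real.sqrt_le_sqrt hLle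
        _ ≤ Real.sqrt (|Real.log D|) + Real.sqrt (ε * Real.log q) := by
            rw [Real.sqrt_le_iff]
            refine ⟨by positivity, ?_⟩
            nlinarith [Real.sq_sqrt ha, Real.sq_sqrt hb, Real.sqrt_nonneg (|Real.log D|),
              Real.sqrt_nonneg (ε * Real.log q)]
    have h2 := mul_le_mul_of_nonneg_left h1 hC0.le
    linarith
  -- E1 = exp(−C√(V L)) ≤ F
  have hE1 : Real.exp (-C * Real.sqrt (V * L)) ≤ F :=
    MatomakiMerikoski.exp_neg_mul_sqrt_antitone hC0.le (le_mul_of_one_le_left hL0.le (by linarith))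
  -- E2 = exp(−c₀ √log X) ≤ exp(−c₀√(10 ℓ)) ≤ e^{−C√(εℓ)} ≤ B₀ F
  have hE2 : Real.exp (-c₀ * Real.sqrt (Real.log X)) ≤ B₀ * F := by
    refine le_trans ?_ hfloor
    rw [Real.exp_le_exp]
    -- `C √(εℓ) ≤ c₀ √(10 ℓ) ≤ c₀ √(log X)`
    have h1 : C * Real.sqrt (ε * Real.log q) ≤ c₀ * Real.sqrt (Real.log X) := by
      have hsq : (C * Real.sqrt (ε * Real.log q)) ^ 2 ≤ (c₀ * Real.sqrt (Real.log X)) ^ 2 := by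
        rw [mul_pow, mul_pow, Real.sq_sqrt (by positivity), Real.sq_sqrt (by linarith)]
        nlinarith [mul_le_mul_of_nonneg_right hεC hℓ0.le]
      have ha : 0 ≤ C * Real.sqrt (ε * Real.log q) := by positivity
      have hb : 0 ≤ c₀ * Real.sqrt (Real.log X) := by positivity
      exact (pow_le_pow_iff_left₀ ha hb two_ne_zero).mp hsq
    linarith
  -- E3 = V L⁶/η ≤ 10 L⁷ e^{−L} ≤ K₃ F
  have hE3 : V * L ^ 6 / η ≤ K₃ * F := by
    have hVL : V * L ^ 6 ≤ 10 * L ^ 7 := by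
      have hL6 : 0 < L ^ 6 := pow_pos hL0 6
      calc V * L ^ 6 ≤ (10 * L) * L ^ 6 := mul_le_mul_of_nonneg_right hVhi hL6.le
        _ = 10 * L ^ 7 := by ring
    calc V * L ^ 6 / η ≤ 10 * L ^ 7 / η := div_le_div_of_nonneg_right hVL hη0.le
      _ = 10 * L ^ 7 * Real.exp (-L) := by rw [Real.exp_neg, hηL, div_eq_mul_inv]
      _ ≤ 10 * Real.exp ((14 + C) ^ 2 / 4) * Real.exp (-C * Real.sqrt L) :=
          MatomakiMerikoski.ten_mul_pow_seven_mul_exp_neg_le C hL0.le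
      _ = K₃ * F := by rw [hK₃def, hFdef]
  -- the correction factor: `|corr| ≤ √(24h/q) ≤ √(24h) e^{C²ε/2} B₀ F`
  have hcorr := SiegelCorr.abs_corr_le (R := ℂ) χ hprim hquad hh
  have hsqrtq : 1 / Real.sqrt q ≤ Real.exp ((C * Real.sqrt ε) ^ 2 / 2) * B₀ * F := by
    have hsq : Real.sqrt q = Real.exp (Real.log q / 2) := by
      rw [← Real.log_sqrt hq0.le, Real.exp_log (Real.sqrt_pos.mpr hq0)]
    have hsqrtmul : Real.sqrt (ε * Real.log q) = Real.sqrt ε * Real.sqrt (Real.log q) :=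
      Real.sqrt_mul hε.le _
    calc 1 / Real.sqrt q = Real.exp (-(Real.log q / 2)) := by
          rw [hsq, Real.exp_neg, one_div]
      _ ≤ Real.exp ((C * Real.sqrt ε) ^ 2 / 2) * Real.exp (-(C * Real.sqrt ε) * Real.sqrt (Real.log q)) :=
          MatomakiMerikoski.exp_neg_half_le (C * Real.sqrt ε) hℓ0.le
      _ = Real.exp ((C * Real.sqrt ε) ^ 2 / 2) * Real.exp (-C * Real.sqrt (ε * Real.log q)) := by
          rw [hsqrtmul]; ring_nf
      _ ≤ Real.exp ((C * Real.sqrt ε) ^ 2 / 2) * (B₀ * F) := by gcongr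
      _ = Real.exp ((C * Real.sqrt ε) ^ 2 / 2) * B₀ * F := by ring
  have hcorr' : Real.sqrt (24 * h / q) ≤
      Real.sqrt (24 * h) * (Real.exp ((C * Real.sqrt ε) ^ 2 / 2) * B₀) * F := by
    rw [Real.sqrt_div' _ hq0.le]
    calc Real.sqrt (24 * h) / Real.sqrt q = Real.sqrt (24 * h) * (1 / Real.sqrt q) := by ring
      _ ≤ Real.sqrt (24 * h) * (Real.exp ((C * Real.sqrt ε) ^ 2 / 2) * B₀ * F) := by gcongr
      _ = Real.sqrt (24 * h) * (Real.exp ((C * Real.sqrt ε) ^ 2 / 2) * B₀) * F := by ring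
  -- Theorem 1.3 (classical form)
  have hhX : (h : ℝ) ≤ h * X := le_mul_of_one_le_right hh0.le hX1
  have hmain := h13' q hq χ hprim hquad η hη hzero V X hV10 hX h hh hhX
  -- assemble
  set S : ℝ := ∑ n ∈ Icc 1 ⌊X⌋₊, Λ n * Λ (n + h) with hSdef
  set corr : ℝ := (if Nat.totient (2 ^ padicValNat 2 q) ∣ h then
        (-1 : ℝ) ^ (h / Nat.totient (2 ^ padicValNat 2 q)) *
          ∏ p ∈ (q / 2 ^ padicValNat 2 q).primeFactors.filter (fun p => ¬ p ∣ h),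
            (-1 : ℝ) / ((p : ℝ) - 2)
      else 0) with hcorrdef
  have htri : |S - X * G| ≤ |S - X * G * (1 + corr)| + |X * G * (1 + corr) - X * G| :=
    abs_sub_le _ _ _
  have hmid : |X * G * (1 + corr) - X * G| = X * |G| * |corr| := by
    rw [show X * G * (1 + corr) - X * G = X * G * corr by ring, abs_mul, abs_mul, abs_of_pos hX0]
  have hsum : Real.exp (-C * Real.sqrt (V * L)) + Real.exp (-c₀ * Real.sqrt (Real.log X))
      + V * L ^ 6 / η ≤ (1 + B₀ + K₃) * F := by
    linarith
  have hc0 : 0 ≤ K₁ * ((h : ℝ) / (Nat.totient h : ℝ)) * X := by positivity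
  calc |S - X * G| ≤ |S - X * G * (1 + corr)| + |X * G * (1 + corr) - X * G| := htri
    _ ≤ K₁ * ((h : ℝ) / (Nat.totient h : ℝ)) * X *
          (Real.exp (-C * Real.sqrt (V * L)) + Real.exp (-c₀ * Real.sqrt (Real.log X))
            + V * L ^ 6 / η) + X * |G| * |corr| := by
        rw [hmid]; exact add_le_add hmain le_rfl
    _ ≤ K₁ * ((h : ℝ) / (Nat.totient h : ℝ)) * X * ((1 + B₀ + K₃) * F) +
          X * |G| * (Real.sqrt (24 * h) * (Real.exp ((C * Real.sqrt ε) ^ 2 / 2) * B₀) * F) := by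
        gcongr
        · exact hcorr.trans hcorr'
    _ = (K₁ * ((h : ℝ) / (Nat.totient h : ℝ)) * (1 + B₀ + K₃) +
          |G| * Real.sqrt (24 * h) * (Real.exp ((C * Real.sqrt ε) ^ 2 / 2) * B₀)) * X * F := by ring
    _ = _ := by rw [hFdef]

end Literature.Barriers.Parity

end
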